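import Summits.QuantumFields.YangMills.Theorems.FluctuationComparisonRegPrIntLS2BetaResidualGaugeOrbit
import HarnessLib

/-!
# REG-ARGMIN IS GAP♯∘'s QUALITATIVE CORE — `GAP♯∘ ∧ EXW∘(2) ⇒ REG-ARGMIN` (crux `FluctuationComparisonRegPrIntL`, stmt-QuantumFields-20520; registry v11.4
# `Cruxes/FluctuationComparisonRegPrIntL/Lines/semiclassical_s2beta.lean` 3732b7df, organs GAP♯∘ `UniformFibreGapOrbit` l.768 ∕ EXW∘ `WindowExactness` l.715; px17 g14 LOCATE-ORB e47193f2)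

Cell `ym3-torus` (YM ladder rung R3 = continuum `SU(2)` Yang–Mills on the three-torus — a RUNG, NOT d = 4, NOT infinite volume, NOT a mass gap, NOT Clay); width seat `ym3-torus-px17`
(gen 14); `--supports stmt-QuantumFields-20520 --as helper`, count-neutral, definition-free, default heartbeats.

WHAT.  LOCATE-ORB (px17 g14) and ✓`…ArgminOrbitOfUniqueCriticalOrbit` (sibling file) isolate the letter REG-ARGMIN(V) := «every point of `argminHist V` is (6)-regular,
`RegPr F J K ε₀ ·`» as what ORB ∕ GAP♯∘ need beyond print's uniqueness letter at unbounded depth.  This file proves the converse bookkeeping, so that REG-ARGMIN is EXACTLY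
GAP♯∘'s qualitative core: ★★ `regArgmin_of_gapOrbit_of_exists` — from the v11.4 text of GAP♯∘ (RG-K substitutions) and EXW∘'s existence clause (2) (a print-regular minimiser
`U₀ ∈ regFibrePr … ε₀ V` with good history and `A(U₀) = minActionRegPr`, = ✓p770212 `windowExactnessExists_of_thm1`'s conclusion text VERBATIM, itself ⟸ [Balaban1985Variational]
Thm 1 (8) alone), every point `U′` of `argminHist V` is (6)-regular: GAP♯∘ at `(U₀, U := U′)` has right side `A(U′) − min = 0`, so the orbit infimum is `≤ 0` and
`U′ = w • U₀` with `w` residual (✓`exists_eq_gaugeAct_of_iInf_le_zero`), and (6) is gauge invariant (lit ✓`regPr_gaugeAct_iff`).  Thresholds merge by `min`∕`max`.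
Pointwise form ★ `regPr_of_gapOrbitAt`.  NET (CREDIT NOTHING): with the sibling file, ORB ⟺-bookkeeping reads «GAP♯∘ ⇒ REG-ARGMIN ⇒ (with Prop. 7 ∕ Thm 1 sentence 2) ORB»;
REG-ARGMIN at unbounded depth is NOT printed and NOT proved; GAP♯∘, EXW∘, S2β, 20520, EX (19200) are NOT proved here; no summit is proved by a helper; rung R3 = SU(2) YM₃ on T³ —
NOT d = 4, NOT infinite volume, NOT a mass gap, NOT Clay.  Sorry-free, axioms standard.

References: T. Bałaban, CMP **102** (1985) 277–309 [Balaban1985Variational] ((2)–(8) p.278, Thm 1 p.279, (142) p.299); CMP **102** (1985) 255–275 [Balaban1985UV3] ((41) p.266).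
-/

set_option autoImplicit false

noncomputable section

namespace Summit.QuantumFields.YangMills.Theorems.FluctuationComparisonRegPrIntLRegArgminOfGapOrbit

open Set
open Literature.MathematicalPhysics.QuantumFieldTheory.Balaban1983to89
open Literature.MathematicalPhysics.QuantumFieldTheory.Balaban1983to89.T3ContinuumYM3Torus
open Literature.MathematicalPhysics.QuantumFieldTheory.Balaban1983to89.T3UnitLawDensityEML (ℰp)
open Literature.MathematicalPhysics.QuantumFieldTheory.Balaban1983to89.T3UnitScaleTilt
open Literature.MathematicalPhysics.QuantumFieldTheory.Balaban1983to89.T3TiltDescent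
open Literature.MathematicalPhysics.QuantumFieldTheory.Balaban1983to89.T3ConstrainedMinimiser (fibre)
open Literature.MathematicalPhysics.QuantumFieldTheory.Balaban1983to89.T3PrintedRegularMinimiser
open Literature.MathematicalPhysics.QuantumFieldTheory.Balaban1983to89.T3PrintedRegularOrbits (regPr_gaugeAct_iff)
open Literature.MathematicalPhysics.QuantumFieldTheory.Balaban1983to89.Missing
open Literature.MathematicalPhysics.QuantumFieldTheory.Balaban1983to89.T4Continuum
open Summit.QuantumFields.YangMills.Theorems.FluctuationComparisonRegPrIntLS2BetaResidualGauge
open Summit.QuantumFields.YangMills.Theorems.FluctuationComparisonRegPrIntLS2BetaResidualGaugeOrbit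

/-! ## §1 Pointwise: GAP♯∘ at one datum with a (6)-regular base point makes every argmin point (6)-regular -/

section Pointwise

variable (F : T3Family) {J K : ℕ} (hJK : J ≤ K) {γ b₀ p₀ ε₀ : ℝ}

/-- ★ **GAP♯∘ AT `(V, U₀)` WITH `U₀` (6)-REGULAR ⇒ EVERY ARGMIN POINT IS (6)-REGULAR**: the excess action of an argmin point vanishes, so its orbit distance to `U₀` is `≤ 0`, so it is
a residual translate of `U₀` (✓`exists_eq_gaugeAct_of_iInf_le_zero`), and (6) is gauge invariant. [cite: Balaban1985Variational, (142) p.299 and p.278 (sentence after (3))] -/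
theorem regPr_of_gapOrbitAt (hε₀ : 0 ≤ ε₀) {μ : ℝ} (hμ : 0 < μ) {V : GaugeField (F.P J) 0 (Matrix.specialUnitaryGroup (Fin 2) ℂ)}
    {U₀ : GaugeField (F.P K) 0 (Matrix.specialUnitaryGroup (Fin 2) ℂ)} (hreg₀ : RegPr F J K ε₀ U₀)
    (hgap : ∀ U ∈ fibre F ℰp J K hJK V, U ∈ histGood F ℰp (θBal F.L γ b₀ p₀) K J →
      μ * ((F.L : ℝ)⁻¹) ^ (2 * (K - J)) *
          (⨅ w : {w : Site (F.P K) 0 → Matrix.specialUnitaryGroup (Fin 2) ℂ |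
              ∀ U : GaugeField (F.P K) 0 (Matrix.specialUnitaryGroup (Fin 2) ℂ),
                descendTo F ℰp J K hJK (GaugeField.gaugeAct w U) = descendTo F ℰp J K hJK U},
            ∑ ℓ : PBond (F.P K) 0,
              dist1 (U ℓ * ((GaugeField.gaugeAct (w : Site (F.P K) 0 → Matrix.specialUnitaryGroup (Fin 2) ℂ) U₀) ℓ)⁻¹) ^ 2)
        ≤ wilsonAction4 U - minActionRegPr F J K hJK ε₀ V) :
    ∀ U' ∈ {U' | U' ∈ fibre F ℰp J K hJK V ∧ U' ∈ histGood F ℰp (θBal F.L γ b₀ p₀) K J ∧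
      wilsonAction4 U' = minActionRegPr F J K hJK ε₀ V}, RegPr F J K ε₀ U' := by
  intro U hU
  have hLpos : (0 : ℝ) < (F.L : ℝ) := Nat.cast_pos.mpr (lt_trans zero_lt_one F.hL.2)
  have hc : 0 < μ * ((F.L : ℝ)⁻¹) ^ (2 * (K - J)) := mul_pos hμ (pow_pos (inv_pos.mpr hLpos) _)
  have h := hgap U hU.1 hU.2.1
  have h0 : wilsonAction4 U - minActionRegPr F J K hJK ε₀ V = 0 := by rw [hU.2.2, sub_self]
  have hI : (⨅ w : {w : Site (F.P K) 0 → Matrix.specialUnitaryGroup (Fin 2) ℂ |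
        ∀ U : GaugeField (F.P K) 0 (Matrix.specialUnitaryGroup (Fin 2) ℂ),
          descendTo F ℰp J K hJK (GaugeField.gaugeAct w U) = descendTo F ℰp J K hJK U},
      ∑ ℓ : PBond (F.P K) 0,
        dist1 (U ℓ * ((GaugeField.gaugeAct (w : Site (F.P K) 0 → Matrix.specialUnitaryGroup (Fin 2) ℂ) U₀) ℓ)⁻¹) ^ 2) ≤ 0 := by
    by_contra hI
    exact absurd (h.trans_eq h0) (not_le.mpr (mul_pos hc (not_le.mp hI)))
  obtain ⟨w, -, hUw⟩ := exists_eq_gaugeAct_of_iInf_le_zero F hJK U U₀ hI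
  rw [hUw]
  exact (regPr_gaugeAct_iff F hε₀ w U₀).mpr hreg₀

end Pointwise

/-! ## §2 The window theorem: GAP♯∘ ∧ EXW∘(2) ⇒ REG-ARGMIN on the interior window -/

section Window

/-- ★★ **REG-ARGMIN ON THE INTERIOR WINDOW ⟸ GAP♯∘ ∧ EXW∘'s EXISTENCE CLAUSE (2).**  Hypotheses: `hGap` = the v11.4 text of `UniformFibreGapOrbit` (with `argminHist`∕`ResidualGauge`
replaced by their bodies), `hEx` = EXW∘'s prefix and window with clause (2) only (= ✓`windowExactnessExists_of_thm1`'s conclusion, ⟸ [Balaban1985Variational] Thm 1 (8)).  Conclusion: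
the same prefix and window, then «every point of `argminHist V` is (6)-regular».  So REG-ARGMIN is implied by GAP♯∘ (given print's existence letter) and, with print's uniqueness letter,
implies ORB (sibling file): it is GAP♯∘'s qualitative core. [cite: Balaban1985Variational, Thm 1 (8) p.279 and (142) p.299] -/
theorem regArgmin_of_gapOrbit_of_exists
    (hGap : ∀ (L : ℕ), ∃ c₀ : ℝ, 0 < c₀ ∧ c₀ ≤ 1 ∧ ∀ (cw : ℝ), 0 < cw → cw ≤ c₀ → ∃ pS : ℝ, ∀ (b₀ p₀ : ℝ), 0 < b₀ → pS ≤ p₀ → 0 < p₀ →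
      ∃ ε₁ : ℝ, 0 < ε₁ ∧ ∀ (ε₀ : ℝ), 0 < ε₀ → ε₀ ≤ ε₁ →
      ∃ γ₁ : ℝ, 0 < γ₁ ∧ ∃ μ : ℝ, 0 < μ ∧ ∀ (F : T3Family) (γ : ℝ), F.L = L → 0 < γ → γ ≤ γ₁ →
        ∀ (J K : ℕ) (hJK : J ≤ K) (V : GaugeField (F.P J) 0 (Matrix.specialUnitaryGroup (Fin 2) ℂ)), PlaqSmall (θBal F.L γ (cw * b₀) p₀ J) V →
          ∀ U₀ ∈ {U' | U' ∈ fibre F ℰp J K hJK V ∧ U' ∈ histGood F ℰp (θBal F.L γ b₀ p₀) K J ∧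
              wilsonAction4 U' = minActionRegPr F J K hJK ε₀ V},
            ∀ U ∈ fibre F ℰp J K hJK V, U ∈ histGood F ℰp (θBal F.L γ b₀ p₀) K J →
              μ * ((F.L : ℝ)⁻¹) ^ (2 * (K - J)) *
                  (⨅ w : {w : Site (F.P K) 0 → Matrix.specialUnitaryGroup (Fin 2) ℂ |
                      ∀ U : GaugeField (F.P K) 0 (Matrix.specialUnitaryGroup (Fin 2) ℂ),
                        descendTo F ℰp J K hJK (GaugeField.gaugeAct w U) = descendTo F ℰp J K hJK U},
                    ∑ ℓ : PBond (F.P K) 0,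
                      dist1 (U ℓ * ((GaugeField.gaugeAct (w : Site (F.P K) 0 → Matrix.specialUnitaryGroup (Fin 2) ℂ) U₀) ℓ)⁻¹) ^ 2)
                ≤ wilsonAction4 U - minActionRegPr F J K hJK ε₀ V)
    (hEx : ∀ (L : ℕ), ∃ c₀ : ℝ, 0 < c₀ ∧ c₀ ≤ 1 ∧ ∀ (cw : ℝ), 0 < cw → cw ≤ c₀ → ∃ pS : ℝ, ∀ (b₀ p₀ : ℝ), 0 < b₀ → pS ≤ p₀ → 0 < p₀ →
      ∃ ε₁ : ℝ, 0 < ε₁ ∧ ∀ (ε₀ : ℝ), 0 < ε₀ → ε₀ ≤ ε₁ →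
      ∃ γ₁ : ℝ, 0 < γ₁ ∧ ∀ (F : T3Family) (γ : ℝ), F.L = L → 0 < γ → γ ≤ γ₁ →
        ∀ (J K : ℕ) (hJK : J ≤ K) (V : GaugeField (F.P J) 0 (Matrix.specialUnitaryGroup (Fin 2) ℂ)), PlaqSmall (θBal F.L γ (cw * b₀) p₀ J) V →
          ∃ U₀ ∈ regFibrePr F J K hJK ε₀ V, U₀ ∈ histGood F ℰp (θBal F.L γ b₀ p₀) K J ∧
            wilsonAction4 U₀ = minActionRegPr F J K hJK ε₀ V) :
    ∀ (L : ℕ), ∃ c₀ : ℝ, 0 < c₀ ∧ c₀ ≤ 1 ∧ ∀ (cw : ℝ), 0 < cw → cw ≤ c₀ → ∃ pS : ℝ, ∀ (b₀ p₀ : ℝ), 0 < b₀ → pS ≤ p₀ → 0 < p₀ →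
      ∃ ε₁ : ℝ, 0 < ε₁ ∧ ∀ (ε₀ : ℝ), 0 < ε₀ → ε₀ ≤ ε₁ →
      ∃ γ₁ : ℝ, 0 < γ₁ ∧ ∀ (F : T3Family) (γ : ℝ), F.L = L → 0 < γ → γ ≤ γ₁ →
        ∀ (J K : ℕ) (hJK : J ≤ K) (V : GaugeField (F.P J) 0 (Matrix.specialUnitaryGroup (Fin 2) ℂ)), PlaqSmall (θBal F.L γ (cw * b₀) p₀ J) V →
          ∀ U' ∈ {U' | U' ∈ fibre F ℰp J K hJK V ∧ U' ∈ histGood F ℰp (θBal F.L γ b₀ p₀) K J ∧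
              wilsonAction4 U' = minActionRegPr F J K hJK ε₀ V}, RegPr F J K ε₀ U' := by
  intro L
  obtain ⟨c₁, hc₁, hc₁1, h₁⟩ := hEx L
  obtain ⟨c₂, hc₂, -, h₂⟩ := hGap L
  refine ⟨min c₁ c₂, lt_min hc₁ hc₂, (min_le_left _ _).trans hc₁1, fun cw hcw0 hcwle => ?_⟩
  obtain ⟨pS₁, h₁'⟩ := h₁ cw hcw0 (hcwle.trans (min_le_left _ _))
  obtain ⟨pS₂, h₂'⟩ := h₂ cw hcw0 (hcwle.trans (min_le_right _ _))
  refine ⟨max pS₁ pS₂, fun b₀ p₀ hb hpS hp => ?_⟩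
  obtain ⟨ε₁, hε₁, h₁''⟩ := h₁' b₀ p₀ hb ((le_max_left _ _).trans hpS) hp
  obtain ⟨ε₂, hε₂, h₂''⟩ := h₂' b₀ p₀ hb ((le_max_right _ _).trans hpS) hp
  refine ⟨min ε₁ ε₂, lt_min hε₁ hε₂, fun ε₀ hε₀ hε₀le => ?_⟩
  obtain ⟨γ₁, hγ₁, H₁⟩ := h₁'' ε₀ hε₀ (hε₀le.trans (min_le_left _ _))
  obtain ⟨γ₂, hγ₂, μ, hμ, H₂⟩ := h₂'' ε₀ hε₀ (hε₀le.trans (min_le_right _ _))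
  refine ⟨min γ₁ γ₂, lt_min hγ₁ hγ₂, fun F γ hFL hγ hγle J K hJK V hV => ?_⟩
  obtain ⟨U₀, hU₀reg, hU₀good, hU₀min⟩ := H₁ F γ hFL hγ (hγle.trans (min_le_left _ _)) J K hJK V hV
  have hU₀arg : U₀ ∈ {U' | U' ∈ fibre F ℰp J K hJK V ∧ U' ∈ histGood F ℰp (θBal F.L γ b₀ p₀) K J ∧
      wilsonAction4 U' = minActionRegPr F J K hJK ε₀ V} :=
    ⟨((mem_regFibrePr_iff F).mp hU₀reg).1, hU₀good, hU₀min⟩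
  exact regPr_of_gapOrbitAt F hJK hε₀.le hμ ((mem_regFibrePr_iff F).mp hU₀reg).2
    (H₂ F γ hFL hγ (hγle.trans (min_le_right _ _)) J K hJK V hV U₀ hU₀arg)

end Window

end Summit.QuantumFields.YangMills.Theorems.FluctuationComparisonRegPrIntLRegArgminOfGapOrbit

end
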